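import Mathlib
import HarnessLib
import Literature.MathematicalPhysics.QuantumLattice.GaugeGroups
import Literature.MathematicalPhysics.QuantumFieldTheory.ConstructiveQFTWave0
import Literature.MathematicalPhysics.QuantumFieldTheory.UnitaryCayleyChart
import Summits.Ventures.LatticeQCDFlow.Scaling.MeanActionTransportInstances

/-!
# LatticeQCDFlow / Scaling — barrier supplement v2.9: THE ENTROPIC CONTRACTION LAW WITHOUT EXACTNESS (paid in `log coLip` or in mean action)

HONEST FRAMING: exact (Metropolis-corrected) sampling algorithms for lattice gauge theory;
figures of merit are autocorrelation/cost numbers at stated couplings and volumes; no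
continuum-physics claim.

THEORY-2.md §5.11 supplement 7 (theory seat GEN-16).  One PROVED supplement to `EntropicTransportLaw`
(`Scaling/BarriersEntropicTransport.lean`, v2.8) and `AccurateTransportContractionLaw`
(`Scaling/BarriersAccurateTransport.lean`, v2.5), in the barrier-docstring format (`technique_class` · `blocks` ·
`because` · `evasions_known` · `scope_caveats` · `nearest_prior_art` · `status`): a `def … : Prop` immediately
DISCHARGED by the instances of `Scaling/MeanActionTransportInstances.lean`.  v2.8 recorded that an ε-robust
version of the SHARP exponent `(d-1)/(2d)` is not available by the density technique (TV-accuracy loses the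
pointwise step; the robust law `AccurateTransportContractionLaw` keeps `1/(16d)`).  v2.9 answers in a different
currency: drop every accuracy hypothesis and charge the deficit to the MEAN ACTION of the model.  In the
transport square of v2.8 this is the statement that the cooling/co-Lipschitz ENTROPIC corner is not an exactness
artefact — unlike the two EXPONENTIAL corners and the heating/Lipschitz corner, which are (see `evasions_known`).
`entropicCooling_of_meanAction` records that the exact laws of v2.8 (cooling half) are the case `Δ_T = 0`.
The barrier NAMES of record (VolumeScalingOfTraining, TopologicalModeCollapse, ExactnessVsExpressivity,
FermionDeterminantCost) are unchanged; the literature named under `nearest_prior_art` is CONTEXT found by search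
(THEORY-2.md §8 (42)), nothing is imported from it.
-/

noncomputable section

namespace Summit.Ventures.LatticeQCDFlow.Barriers

open scoped Matrix.Norms.Frobenius
open Literature.MathematicalPhysics.QuantumFieldTheory.UnitaryCayley (𝔾)
open Literature.MathematicalPhysics.QuantumLattice (u1Rep unitaryFundamentalRep fundamentalRep
  continuous_fundamentalRep)

/-- **Supplement (MeanActionTransportLaw) to ExactnessVsExpressivity / EntropicTransportLaw /
AccurateTransportContractionLaw — WITHOUT EXACTNESS: every co-Lipschitz flow, exact or not, accurate or not,
pays the entropic power law, in `log coLip` or in MEAN ACTION.**  For `G = U(1)` (chordal metric, `κ = 1`),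
`G = U(N)`, `N ≥ 1` (`κ = N²`), and `G = SU(N)`, `N ≥ 2` (`κ = N² - 1`; Hilbert–Schmidt metric), Wilson action
in the defining representation, every `d ≥ 1`: there is `C` such that for every `L ≥ 2`, with
`c_lo(L) = (d-1)L^d(1/2-1/L) - 1/2`, `c_up(L) = ((d-1)L^d+1)/2` and, for a map `T : G^E → G^E` and a law `μ`,
`Δ_T(μ, β) = ∫ S∘T dμ - ⟨S⟩_{Λ_L,β}` (the mean-action EXCESS of the model `T_*μ` over the target `μ_{Λ_L,β}`):
(BETWEEN) for every `1 ≤ β₀ ≤ β` and EVERY `μ_{Λ_L,β₀}`-a.e.-measurable map `T` that is `K'`-co-Lipschitz for the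
sup metric (`dist x y ≤ K'·dist (Tx) (Ty)`) — no push-forward, accuracy or invertibility condition —
`κ(c_lo(L)·log β - c_up(L)·log β₀) - C·L^d ≤ κ·d·L^d·log K' + β·Δ_T(μ_{Λ_L,β₀}, β)`;
(FROM THE PRIOR, `SU(N)`) for every `β ≥ 1` and every `Haar^{⊗E}`-a.e.-measurable `K'`-co-Lipschitz `T`,
`κ·c_lo(L)·log β - C·L^d ≤ κ·d·L^d·log K' + β·Δ_T(Haar^{⊗E}, β)`.  Per link (`d = 4`, `N = 3`, `κd = 32`):
`log K' + β·Δ_T/(32·L^4) ≥ (3/8)(1 - O(1/L))·log β - (3/8 + O(L^{-4}))·log β₀ - C/32`.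
technique_class: deterministic flows realised as ONE map (or a stack read as one map) and USED WITHOUT AN
  EXACTNESS GUARANTEE — raw (un-Metropolized) normalizing-flow samplers, approximately trained coupling-transfer
  / trivializing flows, truncated perturbative (Lüscher-type) flows, flow proposals before the accept/reject step
  — judged jointly by a one-sided modulus (the co-Lipschitz constant) and the FIRST MOMENT of the action under
  the model.
blocks: "the volume-uniform power-law contraction budget of `EntropicTransportLaw` is an artefact of exactness
  that an approximate flow can dodge" — it cannot, except by producing a model HOTTER than its target by an
  EXTENSIVE amount of action: a flow with `κ·d·L^d·log K' ≤ κ(c_lo log β - c_up log β₀) - C L^d - M` has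
  `β·Δ_T ≥ M`; in particular "train small, deploy large, skip the correction" does not escape the law at any
  volume, and a per-link co-Lipschitz budget below `(β/β₀)^{(d-1)/(2d)(1-O(1/L))}` forces a mean-action error
  `≳ L^d·log(β/β₀)/β`, which the Metropolis / reweighting step then has to pay for.
because: PROVED `Theory2.Lattice.U1./UN./SUN.meanActionContractionBetween`,
  `Theory2.Lattice.SUN.meanActionContractionSharp` (`Scaling/MeanActionTransportInstances.lean`), from the
  INTEGRATED STEP 2′ WITHOUT EXACTNESS `log Z_{β₀} - log Z_β + β₀⟨S⟩_{β₀} - β·∫ S∘T dμ_{β₀} ≤ #E(log(A/a) +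
  κ log 4 + κ log K')` (`Theory2.Lattice.neg_log_partitionFunction_sub_integral_le_of_antilipschitz`,
  `Scaling/MeanActionTransportSteps.lean`): a fat measurable partition `B̄(n_i,δ/2) ⊆ c_i ⊆ B̄(n_i,δ)` of `G^E`
  (`Scaling/FatPartition.lean`), the cell masses of `T_*μ_{β₀}` bounded through ONE ball of radius `2K'δ` about a
  preimage point, `Z_β` bounded below on the charged cells, finite Jensen, `δ → 0` — i.e. the Gibbs variational
  principle `log Z_β ≥ -β·E_q S - D(q ‖ Haar^{⊗E})` at `q = T_*μ_{β₀}` plus "a `K'`-co-Lipschitz map raises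
  `D(· ‖ Haar^{⊗E})` by at most `κ·#E·log 4K'`"; then the Gibbs identity `D_β = -β⟨S⟩_β - log Z_β` and the tree's
  two-sided sharp entropy growth `κ·c_lo(L)·log β - C L^d ≤ D_β ≤ κ·c_up(L)·log β + C L^d`; `#E = d·L^d`.
evasions_known: (i) a HOT MODEL — the law is a trade-off, not a bound on `K'` alone: the identity map (`K' = 1`,
  `Δ_T = ⟨S⟩_{β₀} - ⟨S⟩_β`) satisfies it with room; such a model is far from `μ_{Λ,β}` and pays at the accept /
  reject or reweighting step instead (not quantified here); (ii) STOCHASTIC layers are not maps and pay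
  `CapacityRatioLaw` / `AnnealingStepLaw` (`Scaling/BarriersEntropyBetween.lean`, `Scaling/Barriers.lean`);
  (iii) the HEATING direction has NO analogue of this kind — a Lipschitz bound controls the entropy of the model
  only from ABOVE, and an inexact heating flow may simply fail to spread (`T = id` defeats every lower bound on
  `Lip T`): the heating/Lipschitz corner of `EntropicTransportLaw` and both exponential corners
  (`TransportWindowLaw`, `HeatingContractionLaw`) remain genuine exactness (or TV-accuracy) statements;
  (iv) references that are not Wilson measures of the same action (tailed / Lie-algebra priors).
scope_caveats: a NECESSARY condition on one map; the MEAN ACTION is the only statistic of the model that enters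
  (a model with the right mean action and wrong in every other respect satisfies the law exactly as an exact
  transport does — the law constrains `K'`, not fidelity); `β₀, β ≥ 1`, `L ≥ 2`; empty for windows
  `log(β/β₀) ≲ (2/L)·log β` as for `EntropicTransportLaw`; `T` is assumed a.e.-measurable for `μ_{Λ,β₀}`
  (automatic for Borel maps); constants `C = 2C_EG + d·(log(A/a) + κ·log 4)` not optimised (the `κ·log 4` is the
  price of finite resolution).
nearest_prior_art: the Gibbs variational principle / maximum-entropy characterisation of Gibbs states
  (Cover–Thomas, *Elements of Information Theory* 2nd ed., Thm 12.1.1; Georgii, *Gibbs Measures and Phase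
  Transitions*, Ch. 15) and the displacement of entropy under Lipschitz maps (Villani, *Topics in Optimal
  Transportation* (2003) §9.4; Mikulincer–Shenfeld, LNM 2327 (2023) 237–246) — combined here, in metric-measure
  form on a compact group (two-sided Haar ball volumes, no smoothness, no injectivity), into a NECESSITY law for
  INEXACT deterministic samplers.  In the flow-sampling literature inexactness is measured by ESS / acceptance /
  reverse KL and the same variational inequality is read for the free energy (`F ≤ F_q`: Nicoli et al.,
  Phys. Rev. Lett. 126 (2021) 032001 = arXiv:2007.07115), never for the modulus of the map.  Searched
  (THEORY-2.md §8 (42), corpus fts+vec and galaxy): no printed statement of this kind for lattice gauge flows.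
status: PROVED (`meanActionTransportLaw`). -/
def MeanActionTransportLaw : Prop :=
  (∀ d : ℕ, 1 ≤ d → Theory2.Lattice.MeanActionContractionBetween d 1 Circle u1Rep 1) ∧
  (∀ d N : ℕ, 1 ≤ d → 1 ≤ N →
    @Theory2.Lattice.MeanActionContractionBetween d N (𝔾 N) _ Subtype.metricSpace
      Theory2.Lattice.UN.isTopologicalGroup_hs Theory2.Lattice.UN.compactSpace_hs _
      Theory2.Lattice.UN.borelSpace_hs (unitaryFundamentalRep (Fin N) ℂ) ((N : ℝ) ^ 2)) ∧
  (∀ d N : ℕ, 1 ≤ d → 2 ≤ N →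
    @Theory2.Lattice.MeanActionContractionBetween d N (Matrix.specialUnitaryGroup (Fin N) ℂ) _
      Subtype.metricSpace Theory2.Lattice.SUN.isTopologicalGroup_hs Theory2.Lattice.SUN.compactSpace_hs _
      Theory2.Lattice.SUN.borelSpace_hs (fundamentalRep (Fin N)) ((N : ℝ) ^ 2 - 1) ∧
    @Theory2.Lattice.MeanActionContractionSharp d N (Matrix.specialUnitaryGroup (Fin N) ℂ) _
      Subtype.metricSpace Theory2.Lattice.SUN.isTopologicalGroup_hs Theory2.Lattice.SUN.compactSpace_hs _
      Theory2.Lattice.SUN.borelSpace_hs (fundamentalRep (Fin N)) ((N : ℝ) ^ 2 - 1))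

/-- Discharge of `MeanActionTransportLaw` by the instances of `Scaling/MeanActionTransportInstances.lean`. -/
theorem meanActionTransportLaw : MeanActionTransportLaw :=
  ⟨fun d hd => Theory2.Lattice.U1.meanActionContractionBetween d hd,
    fun d N hd hN => Theory2.Lattice.UN.meanActionContractionBetween d N hd hN,
    fun d N hd hN => ⟨Theory2.Lattice.SUN.meanActionContractionBetween d N hd hN,
      Theory2.Lattice.SUN.meanActionContractionSharp d N hd hN⟩⟩

/-- **The mean-action law contains the exact entropic cooling laws of v2.8 (`SU(N)`) as the case `Δ_T = 0`**:
`Theory2.Lattice.CoolingContractionBetween` and `Theory2.Lattice.ExactTransportContractionSharp` for `SU(N)`,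
`N ≥ 2`, `d ≥ 1`, `κ = N² - 1`, via `coolingContractionBetween_of_meanAction` /
`exactTransportContractionSharp_of_meanAction` (an exact transport is a.e.-measurable and has zero defect). -/
theorem entropicCooling_of_meanAction (h : MeanActionTransportLaw) (d N : ℕ) (hd : 1 ≤ d) (hN : 2 ≤ N) :
    @Theory2.Lattice.CoolingContractionBetween d N (Matrix.specialUnitaryGroup (Fin N) ℂ) _
      Subtype.metricSpace Theory2.Lattice.SUN.isTopologicalGroup_hs Theory2.Lattice.SUN.compactSpace_hs _
      Theory2.Lattice.SUN.borelSpace_hs (fundamentalRep (Fin N)) ((N : ℝ) ^ 2 - 1) ∧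
    @Theory2.Lattice.ExactTransportContractionSharp d N (Matrix.specialUnitaryGroup (Fin N) ℂ) _
      Subtype.metricSpace Theory2.Lattice.SUN.isTopologicalGroup_hs Theory2.Lattice.SUN.compactSpace_hs _
      Theory2.Lattice.SUN.borelSpace_hs (fundamentalRep (Fin N)) ((N : ℝ) ^ 2 - 1) :=
  ⟨@Theory2.Lattice.coolingContractionBetween_of_meanAction N (Matrix.specialUnitaryGroup (Fin N) ℂ) _
      Subtype.metricSpace Theory2.Lattice.SUN.isTopologicalGroup_hs Theory2.Lattice.SUN.compactSpace_hs
      Theory2.Lattice.SUN.secondCountable_hs _ Theory2.Lattice.SUN.borelSpace_hs (fundamentalRep (Fin N)) d _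
      (continuous_fundamentalRep (Fin N)) (Theory2.Lattice.SUN.re_trace_le N) (h.2.2 d N hd hN).1,
    @Theory2.Lattice.exactTransportContractionSharp_of_meanAction N (Matrix.specialUnitaryGroup (Fin N) ℂ) _
      Subtype.metricSpace Theory2.Lattice.SUN.isTopologicalGroup_hs Theory2.Lattice.SUN.compactSpace_hs
      Theory2.Lattice.SUN.secondCountable_hs _ Theory2.Lattice.SUN.borelSpace_hs (fundamentalRep (Fin N)) d _
      (continuous_fundamentalRep (Fin N)) (Theory2.Lattice.SUN.re_trace_le N) (h.2.2 d N hd hN).2⟩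

end Summit.Ventures.LatticeQCDFlow.Barriers
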